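import Literature.MathematicalPhysics.QuantumFieldTheory.Balaban1983to89.B9GraphZdDegree

/-!
# `Balaban1983to89.B9GraphZdBallGrowth` — [Balaban1984PropagatorsII] Lemma 2.1 (2.61) p. 234 «sup_y Σ_{y′∈𝔅} e^{−αδ₀d(y,y′)} ≤ c₁(α)», THE CRUDE MEMBER-UNIFORM FORM
# ON THE `ℤᵈ` FRAME: balls of the block graph grow at most like `(D+1)ⁿ` (`D = 3^d + 2(L+2)^d` the degree bound of `B9GraphZdDegree`), hence on a finite member
# with connected block graph the ROW LETTER of the local-to-global summations holds with the member-UNIFORM constant `(1 − (D+1)e^{−κ})⁻¹` WHENEVER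
# `(D+1)·e^{−κ} < 1` — an honest but crude regime (NOT print's (2.59); see HONEST SCOPE)

statement-level skeleton of published theorems with citation tags; proofs where landed; nothing here is a claim about the
Yang–Mills mass gap

PDF held: `paper:balaban1984-cmp96-propagators-rt-ii` ([4] of [B9]; journal page = PDF page + 222): p. 234 Lemma 2.1 (2.59)–(2.61) (page image read by this seat,
2026-08-28: «For the numbers α, 0 < α < 1, c₁(α) = 12c₀^d(½α), and RM satisfying (2.59) …»); `B9GraphZdDegree` (this seat: the degree bound), `B9Eq347GlobalFromLocal`
(leaf-03: the row letter's consumer) — BY NAME.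

WHY THIS FILE (cell `pub-ymgap`, HUMAN RULING D-0062 ∕ D-0149; seat `pub-ymgap-dag-n06-w2` (g2), node N06 = [B9]; INTENT-6; count-neutral).  The summations at the
`ℤᵈ` frame display the row letter `Σ_v e^{−κ·d(u,v)} ≤ S`; g0's `rowLetter_of_fintype` inhabits it with `S = |𝔅|` (member-dependent).  With the degree bound of
`B9GraphZdDegree` the simplest member-UNIFORM inhabitant follows from exponential ball growth: `#{v : d(u,v) ≤ n} ≤ (D+1)ⁿ`, so `Σ_v e^{−κ d(u,v)} ≤ Σ_n (D+1)ⁿe^{−κn}`.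
This is print's (2.61) only in SHAPE: print's constant is uniform for EVERY `α > 0` once `RM` satisfies (2.59) (polynomial growth within a level, (2.60) across
levels); the bound here needs `κ > log(D+1) ≈ d·log L`, which the decay rates of [B9] Thm 3.3 do not meet for large `L` — recorded as such.  Value: the ball
growth lemma (generic) + the first member-uniform row letter on the frame, with its regime displayed.

WHAT IS PROVED (0 sorry; proof lane — no `def`).
* §1 (any simple graph with finite neighbour sets of size `≤ D`) `walkBall_zero`, `walkBall_succ_subset`, ★ `ncard_walkBall_le` — `{v | ∃ walk u → v of length ≤ n}` is
  finite with at most `(D+1)ⁿ` elements; `ncard_distBall_le` (the same for `{v | Reachable u v ∧ dist u v ≤ n}`).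
* §2 ★ `ncard_distBall_graphZd_le` — on the frame's block graph under `Sep22Zd R` (`R ≥ 1`, `M > 0`), `L ≥ 1`, laws (T)(V): `≤ (3^d + 2(L+2)^d + 1)ⁿ`.
* §3 ★★ `rowLetter_uniform_of_connected` — on a finite member whose block graph is connected: `Σ_v e^{−κ·distZd(u,v)} ≤ (1 − (D+1)e^{−κ})⁻¹` for `(D+1)e^{−κ} < 1`
  (`D = 3^d + 2(L+2)^d`), uniformly in the member.
HONEST SCOPE.  Crude counting; the regime `κ > log(D+1)` is NOT print's and is not met by [B9]'s `δ₀` at large `L` — the print-regime row letter ((2.59)-type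
condition on `RM`, uniform in `α`) needs the per-level polynomial growth and is NOT here; connectivity displayed (g0's (L1): `distZd = 0` off components).
Count-neutral; N05∕N06 NOT discharged; one finite lattice programme at fixed `ε`; R4 closes the conditional finite-𝕋⁴ rung `BalabanLadder.UV` only; nothing
continuum ∕ ℝ⁴ ∕ OS ∕ mass-gap ∕ Clay.  Unit `pub-ymgap-dag-n06-w2` (g2), 2026-08-28.
-/

namespace Literature.MathematicalPhysics.QuantumFieldTheory.Balaban1983to89.B9GraphZdBallGrowth

open B8LeafModelZd (ZdIdx)
open B9SupplySockB9P3ZdFrame (MemberZd BSite blockZd graphZd distZd Sep22Zd)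
open B9GraphZdDegree (ncard_neighbors_le)

-- `Site` alone could resolve to the torus sites of `Setup.lean`; re-export the `ℤ^d` sites of `B7Prop1Explicit`.
export B7Prop1Explicit (Site)

/-! ## §1 Exponential ball growth in a graph with bounded finite neighbour sets -/

section Generic

variable {V : Type*} {G : SimpleGraph V} {D : ℕ}

/-- the walk-ball of radius `0` is `{u}`. [cite: Balaban1984PropagatorsII, Lemma 2.1 (2.61) p.234 (bookkeeping of the counting)] -/
theorem walkBall_zero (u : V) : {v : V | ∃ p : G.Walk u v, p.length ≤ 0} = {u} := by
  ext v
  simp only [Set.mem_setOf_eq, Set.mem_singleton_iff, Nat.le_zero]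
  constructor
  · rintro ⟨p, hp⟩; exact (SimpleGraph.Walk.eq_of_length_eq_zero hp).symm
  · rintro rfl; exact ⟨SimpleGraph.Walk.nil, rfl⟩

/-- **one more step**: a vertex reached in `≤ n + 1` steps is reached in `≤ n` steps or is a neighbour of one that is (drop the last edge). [cite: Balaban1984PropagatorsII, Lemma 2.1 (2.61) p.234 (bookkeeping of the counting)] -/
theorem walkBall_succ_subset (u : V) (n : ℕ) :
    {v : V | ∃ p : G.Walk u v, p.length ≤ n + 1} ⊆
      {v : V | ∃ p : G.Walk u v, p.length ≤ n} ∪ ⋃ w ∈ {v : V | ∃ p : G.Walk u v, p.length ≤ n}, {v : V | G.Adj w v} := by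
  rintro v ⟨p, hp⟩
  by_cases hle : p.length ≤ n
  · exact Or.inl ⟨p, hle⟩
  · have hlen : p.length = n + 1 := by omega
    have hnn : ¬ p.Nil := by
      rw [← SimpleGraph.Walk.length_eq_zero_iff]; omega
    refine Or.inr (Set.mem_biUnion (x := p.penultimate) ?_ ?_)
    · exact ⟨p.dropLast, by rw [SimpleGraph.Walk.length_dropLast]; omega⟩
    · exact p.adj_penultimate hnn

/-- ★ **EXPONENTIAL BALL GROWTH**: if every vertex has a finite neighbour set with at most `D` elements, the vertices reachable in `≤ n` steps form a finite set of at
most `(D+1)ⁿ` elements. [cite: Balaban1984PropagatorsII, Lemma 2.1 (2.61) p.234 (the counting it needs, crude form)] -/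
theorem ncard_walkBall_le (hdeg : ∀ w : V, ({v : V | G.Adj w v}).Finite ∧ ({v : V | G.Adj w v}).ncard ≤ D) (u : V) (n : ℕ) :
    ({v : V | ∃ p : G.Walk u v, p.length ≤ n}).Finite ∧ ({v : V | ∃ p : G.Walk u v, p.length ≤ n}).ncard ≤ (D + 1) ^ n := by
  classical
  induction n with
  | zero =>
    rw [walkBall_zero]
    exact ⟨Set.finite_singleton u, by simp⟩
  | succ n ih =>
    obtain ⟨hfin, hcard⟩ := ih
    set S : Set V := {v : V | ∃ p : G.Walk u v, p.length ≤ n} with hS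
    have hUfin : (⋃ w ∈ S, {v : V | G.Adj w v}).Finite := hfin.biUnion fun w _ => (hdeg w).1
    have hsub := walkBall_succ_subset (G := G) u n
    rw [← hS] at hsub
    have hfin' : ({v : V | ∃ p : G.Walk u v, p.length ≤ n + 1}).Finite := (hfin.union hUfin).subset hsub
    refine ⟨hfin', ?_⟩
    -- the union of the neighbour sets has at most `|S|·D` elements
    have hU : (⋃ w ∈ S, {v : V | G.Adj w v}).ncard ≤ S.ncard * D := by
      have hsubU : (⋃ w ∈ S, {v : V | G.Adj w v}) ⊆ ↑(hfin.toFinset.biUnion fun w => (hdeg w).1.toFinset) := by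
        intro v hv
        simp only [Set.mem_iUnion, Set.mem_setOf_eq, exists_prop] at hv
        obtain ⟨w, hw, hwv⟩ := hv
        simp only [Finset.coe_biUnion, Finset.mem_coe, Set.Finite.mem_toFinset, Set.mem_iUnion, Set.mem_setOf_eq, exists_prop]
        exact ⟨w, hw, hwv⟩
      calc (⋃ w ∈ S, {v : V | G.Adj w v}).ncard ≤ (↑(hfin.toFinset.biUnion fun w => (hdeg w).1.toFinset) : Set V).ncard :=
            Set.ncard_le_ncard hsubU (Finset.finite_toSet _)
        _ = (hfin.toFinset.biUnion fun w => (hdeg w).1.toFinset).card := Set.ncard_coe_finset _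
        _ ≤ ∑ w ∈ hfin.toFinset, ((hdeg w).1.toFinset).card := Finset.card_biUnion_le
        _ ≤ ∑ _w ∈ hfin.toFinset, D := Finset.sum_le_sum fun w _ => by
            rw [← Set.ncard_eq_toFinset_card _ (hdeg w).1]; exact (hdeg w).2
        _ = S.ncard * D := by rw [Finset.sum_const, smul_eq_mul, Set.ncard_eq_toFinset_card S hfin]
    calc ({v : V | ∃ p : G.Walk u v, p.length ≤ n + 1}).ncard
        ≤ (S ∪ ⋃ w ∈ S, {v : V | G.Adj w v}).ncard := Set.ncard_le_ncard hsub (hfin.union hUfin)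
      _ ≤ S.ncard + (⋃ w ∈ S, {v : V | G.Adj w v}).ncard := Set.ncard_union_le _ _
      _ ≤ S.ncard + S.ncard * D := Nat.add_le_add_left hU _
      _ = S.ncard * (D + 1) := by ring
      _ ≤ (D + 1) ^ n * (D + 1) := Nat.mul_le_mul_right _ hcard
      _ = (D + 1) ^ (n + 1) := by rw [pow_succ]

/-- ★ the same for the metric ball `{v | Reachable u v ∧ dist u v ≤ n}` (a shortest walk has length `dist ≤ n`). [cite: Balaban1984PropagatorsII, Lemma 2.1 (2.61) p.234 (bookkeeping of the counting)] -/
theorem ncard_distBall_le (hdeg : ∀ w : V, ({v : V | G.Adj w v}).Finite ∧ ({v : V | G.Adj w v}).ncard ≤ D) (u : V) (n : ℕ) :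
    ({v : V | G.Reachable u v ∧ G.dist u v ≤ n}).Finite ∧ ({v : V | G.Reachable u v ∧ G.dist u v ≤ n}).ncard ≤ (D + 1) ^ n := by
  have hsub : {v : V | G.Reachable u v ∧ G.dist u v ≤ n} ⊆ {v : V | ∃ p : G.Walk u v, p.length ≤ n} := by
    rintro v ⟨hr, hd⟩
    obtain ⟨p, hp⟩ := hr.exists_walk_length_eq_dist
    exact ⟨p, by rw [hp]; exact hd⟩
  obtain ⟨hfin, hcard⟩ := ncard_walkBall_le hdeg u n
  exact ⟨hfin.subset hsub, (Set.ncard_le_ncard hsub hfin).trans hcard⟩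

end Generic

/-! ## §2 The frame's block graph -/

section Frame

variable {d L : ℕ} {x : MemberZd d L}
  (hT : ∀ y : BSite L x, blockZd L y.1.1 y.1.2 ⊆ x.i.Ω y.1.1)
  (hV : ∀ (y : BSite L x) (z : Site d), z ∈ blockZd L y.1.1 y.1.2 → ∀ j, j ≤ x.m → z ∈ x.i.Ω j → j ≤ y.1.1)

include hT hV in
/-- ★ **BALL GROWTH ON THE BLOCK GRAPH OF THE MEMBER**: `#{v : d(u,v) ≤ n} ≤ (3^d + 2(L+2)^d + 1)ⁿ` under `Sep22Zd R` (`1 ≤ R`, `0 < M`), `1 ≤ L`, laws (T)(V).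
[cite: Balaban1984PropagatorsII, (2.2) p.224, Lemma 2.1 (2.61) p.234 (crude counting)] -/
theorem ncard_distBall_graphZd_le (hL : 1 ≤ L) {R : ℕ} (hR : 1 ≤ R) (hM : 0 < x.M) (hsep : Sep22Zd R x) (u : BSite L x) (n : ℕ) :
    ({v : BSite L x | (graphZd L x).Reachable u v ∧ (graphZd L x).dist u v ≤ n}).Finite ∧
      ({v : BSite L x | (graphZd L x).Reachable u v ∧ (graphZd L x).dist u v ≤ n}).ncard ≤ (3 ^ d + 2 * (L + 2) ^ d + 1) ^ n :=
  ncard_distBall_le (fun w => ncard_neighbors_le hT hV hL hR hM hsep w) u n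

end Frame

/-! ## §3 The crude member-uniform row letter on a finite member with connected block graph -/

section Row

variable {d L : ℕ} {x : MemberZd d L}
  (hT : ∀ y : BSite L x, blockZd L y.1.1 y.1.2 ⊆ x.i.Ω y.1.1)
  (hV : ∀ (y : BSite L x) (z : Site d), z ∈ blockZd L y.1.1 y.1.2 → ∀ j, j ≤ x.m → z ∈ x.i.Ω j → j ≤ y.1.1)

/-- **summing a function of the distance over a finite vertex set by shells**: with the shell counts `#{v : d(u,v) = n} ≤ N n`,
`Σ_v f(d(u,v)) ≤ Σ_{n ≤ |V|} N n · f n`-type bound — here in the form we need: for `f ≥ 0` antitone in `n` it suffices to bound by balls; we use the direct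
shell decomposition `Σ_v g v = Σ_n Σ_{v : d = n} g v`. [cite: Balaban1984PropagatorsII, Lemma 2.1 (2.61) p.234 (bookkeeping of the summation)] -/
theorem sum_by_dist {ι : Type*} [Fintype ι] (dist : ι → ℕ) (g : ι → ℝ) (N : ℕ) (hN : ∀ v, dist v ≤ N) :
    ∑ v, g v = ∑ n ∈ Finset.range (N + 1), ∑ v ∈ Finset.univ.filter (fun v => dist v = n), g v := by
  classical
  rw [← Finset.sum_fiberwise_of_maps_to (s := Finset.univ) (t := Finset.range (N + 1)) (g := dist) (f := g)]
  intro v _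
  exact Finset.mem_range.mpr (Nat.lt_succ_of_le (hN v))

include hT hV in
/-- ★★ **THE CRUDE MEMBER-UNIFORM ROW LETTER**: on a finite member whose block graph is connected, under `Sep22Zd R` (`1 ≤ R`, `0 < M`), `1 ≤ L`, laws (T)(V), and the
regime `(D+1)·e^{−κ} < 1` with `D = 3^d + 2(L+2)^d`: `Σ_v e^{−κ·distZd(u,v)} ≤ (1 − (D+1)e^{−κ})⁻¹` for every block `u` — uniformly in the member.  (Shells:
`#{d = n} ≤ #{d ≤ n} ≤ (D+1)ⁿ`; geometric series.)  NOT print's regime — see the module docstring. [cite: Balaban1984PropagatorsII, Lemma 2.1 (2.61) p.234 (shape; crude regime)] -/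
theorem rowLetter_uniform_of_connected [Fintype (BSite L x)] (hL : 1 ≤ L) {R : ℕ} (hR : 1 ≤ R) (hM : 0 < x.M) (hsep : Sep22Zd R x)
    (hconn : ∀ u v : BSite L x, (graphZd L x).Reachable u v) {κ : ℝ}
    (hreg : ((3 ^ d + 2 * (L + 2) ^ d + 1 : ℕ) : ℝ) * Real.exp (-κ) < 1) (u : BSite L x) :
    ∑ v, Real.exp (-(κ * distZd L x u v)) ≤ (1 - ((3 ^ d + 2 * (L + 2) ^ d + 1 : ℕ) : ℝ) * Real.exp (-κ))⁻¹ := by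
  classical
  set Dp : ℕ := 3 ^ d + 2 * (L + 2) ^ d + 1 with hDp
  set r : ℝ := (Dp : ℝ) * Real.exp (-κ) with hr
  have hr0 : 0 ≤ r := by positivity
  have hr1 : r < 1 := hreg
  -- distances are bounded by the number of blocks (shortest walks are paths)
  set N : ℕ := Fintype.card (BSite L x) with hN
  have hdistN : ∀ v : BSite L x, (graphZd L x).dist u v ≤ N := by
    intro v
    obtain ⟨p, hp, hlen⟩ := (hconn u v).exists_path_of_dist
    rw [← hlen]
    have := hp.length_lt
    omega
  -- shell decomposition and the term-wise identity `e^{−κ d} = (e^{−κ})^d`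
  rw [sum_by_dist (fun v => (graphZd L x).dist u v) _ N hdistN]
  have hshell : ∀ n ∈ Finset.range (N + 1),
      ∑ v ∈ Finset.univ.filter (fun v : BSite L x => (graphZd L x).dist u v = n), Real.exp (-(κ * distZd L x u v)) ≤ r ^ n := by
    intro n _
    have hterm : ∀ v ∈ Finset.univ.filter (fun v : BSite L x => (graphZd L x).dist u v = n),
        Real.exp (-(κ * distZd L x u v)) = Real.exp (-κ) ^ n := by
      intro v hv
      rw [Finset.mem_filter] at hv
      rw [B9SupplySockB9P3ZdFrame.distZd, hv.2, ← Real.exp_nat_mul]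
      congr 1; ring
    rw [Finset.sum_congr rfl hterm, Finset.sum_const, nsmul_eq_mul, hr, mul_pow]
    refine mul_le_mul_of_nonneg_right ?_ (pow_nonneg (Real.exp_nonneg _) n)
    -- the shell lies in the ball of radius `n`
    have hcount : (Finset.univ.filter (fun v : BSite L x => (graphZd L x).dist u v = n)).card ≤ Dp ^ n := by
      have hsub : (↑(Finset.univ.filter (fun v : BSite L x => (graphZd L x).dist u v = n)) : Set (BSite L x)) ⊆
          {v : BSite L x | (graphZd L x).Reachable u v ∧ (graphZd L x).dist u v ≤ n} := by
        intro v hv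
        simp only [Finset.coe_filter, Finset.mem_univ, true_and, Set.mem_setOf_eq] at hv
        exact ⟨hconn u v, hv.le⟩
      obtain ⟨hfin, hcard⟩ := ncard_distBall_graphZd_le hT hV hL hR hM hsep u n
      have h1 := Set.ncard_le_ncard hsub hfin
      rw [Set.ncard_coe_finset] at h1
      exact h1.trans (hDp ▸ hcard)
    exact_mod_cast hcount
  calc ∑ n ∈ Finset.range (N + 1), ∑ v ∈ Finset.univ.filter (fun v : BSite L x => (graphZd L x).dist u v = n), Real.exp (-(κ * distZd L x u v))
      ≤ ∑ n ∈ Finset.range (N + 1), r ^ n := Finset.sum_le_sum hshell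
    _ ≤ ∑' n, r ^ n := Summable.sum_le_tsum _ (fun n _ => pow_nonneg hr0 n) (summable_geometric_of_lt_one hr0 hr1)
    _ = (1 - r)⁻¹ := tsum_geometric_of_lt_one hr0 hr1

end Row

end Literature.MathematicalPhysics.QuantumFieldTheory.Balaban1983to89.B9GraphZdBallGrowth
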